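import Summits.CriticalPhenomena.PercolationContinuityZ3.Theorems.PercNearOneGluingNoHeavyLowerTailAttachedChampion
import HarnessLib

/-!
# `NoHeavyLowerTail` (stmt-CriticalPhenomena-4575) — the crux from 'Kozma–Nitzan's Lemma 3(i) for a SET of relays' (UX)

Support file (prover `prim-hp-5`, hull-port cell, gen 11; `--supports stmt-CriticalPhenomena-4575`).  No definitions,
no named facts, no sorries.  `μ = prodBernoulli w` on `Fin n`, relays `A`, level `j`, `π(v) = {x ∈ A : v ↔ x}`.

**The family UX** (memo OBSERVER-SET.md §24; hypothesis `hUX` below; census: 0 violations in 2·10⁵ (instance, champion)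
cases of the ttrl2 end-point bank, all `X`, `n ≤ 9`, `|A| ≤ 6`, glued observer sets of size ≤ 4).  For a relay `q`, an
observer `o ∉ A` and a set `X ⊆ A ∖ q` of relays each of which `q` beats at level `j` (`μ(|π(b)| ≤ j) ≤ μ(|π(q)| ≤ j)`):

  `μ(o ↔ X, |π(o)| ≤ j) ≤ μ(o ↔ X, |π(q)| ≤ j)`.

For `X = {r}` this is Kozma–Nitzan's Lemma 3(i) (a theorem); its level `j = 1` is `Theorems.ux_level_one` (all `X`); for
`X = A ∖ q` and a champion `q` it is the attached-champion inequality (XZ), hence the crux: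

* `attachedChampion_of_UX` — `hUX` ⇒ the registered stub `stub_attachedChampion` (split `{o ↔ A}` into `{o ↔ A∖q}` and
  `{o ↔ q} ∖ {o ↔ A∖q}`, on which `|π(o)| = |π(q)|`);
* `noHeavyLowerTail_of_UX` — `hUX` ⇒ `NoHeavyLowerTail` (via `noHeavyLowerTail_of_attachedChampion`).
Via the hub transfer (`…CILSharpHardness`) `hUX` restricted to `|X| = 2` already contains Kozma–Nitzan's pre-FKG inequality (3)
at the minimiser for `|A| = 3`; nothing here asserts `hUX`.
-/

noncomputable section

namespace Summit.CriticalPhenomena.PercolationContinuityZ3.Theorems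

open MeasureTheory Set Literature.Probability.LatticeModels Literature.Probability.Percolation
open scoped Classical BigOperators

/-- **UX ⇒ the attached-champion inequality** (the registered stub `stub_attachedChampion`, verbatim shape): apply `hUX` with
`X = A ∖ q` (a champion beats every relay) and add the common piece `{o ↔ q} ∖ {o ↔ A∖q}`, on which `π(o) = π(q)`.
[cite: KozmaNitzan2024, Lemma 3(i) (pp. 6–7)] -/
theorem attachedChampion_of_UX
    (hUX : ∀ (n : ℕ) (w : Sym2 (Fin n) → unitInterval) (A X : Finset (Fin n)) (o q : Fin n) (j : ℕ),
      o ∉ A → q ∈ A → X ⊆ A.erase q →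
      (∀ b ∈ X,
        (prodBernoulli w).real {ω : BondConfig (Fin n) | (A.filter fun x => ω ∈ openConn b x).card ≤ j} ≤
          (prodBernoulli w).real {ω : BondConfig (Fin n) | (A.filter fun x => ω ∈ openConn q x).card ≤ j}) →
      (prodBernoulli w).real ((⋃ b ∈ X, openConn o b) ∩
          {ω : BondConfig (Fin n) | (A.filter fun x => ω ∈ openConn o x).card ≤ j}) ≤
        (prodBernoulli w).real ((⋃ b ∈ X, openConn o b) ∩
          {ω : BondConfig (Fin n) | (A.filter fun x => ω ∈ openConn q x).card ≤ j}))
    (n : ℕ) (w : Sym2 (Fin n) → unitInterval) (A : Finset (Fin n)) (o q : Fin n) (j : ℕ) (ho : o ∉ A) (hq : q ∈ A)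
    (hchamp : ∀ a ∈ A,
      (prodBernoulli w).real {ω : BondConfig (Fin n) | (A.filter fun x => ω ∈ openConn a x).card ≤ j} ≤
        (prodBernoulli w).real {ω : BondConfig (Fin n) | (A.filter fun x => ω ∈ openConn q x).card ≤ j}) :
    (prodBernoulli w).real {ω : BondConfig (Fin n) |
        1 ≤ (A.filter fun x => ω ∈ openConn o x).card ∧ (A.filter fun x => ω ∈ openConn o x).card ≤ j} ≤
      (prodBernoulli w).real {ω : BondConfig (Fin n) |
        (A.filter fun x => ω ∈ openConn q x).card ≤ j ∧ 1 ≤ (A.filter fun x => ω ∈ openConn o x).card} := by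
  set μ := prodBernoulli w with hμ
  set X : Finset (Fin n) := A.erase q with hX
  set U : Set (BondConfig (Fin n)) := ⋃ b ∈ X, openConn o b with hU
  set Lo : Set (BondConfig (Fin n)) := {ω | (A.filter fun x => ω ∈ openConn o x).card ≤ j} with hLo
  set Lq : Set (BondConfig (Fin n)) := {ω | (A.filter fun x => ω ∈ openConn q x).card ≤ j} with hLq
  -- the common piece `R = {o ↔ q} ∖ U`, on which `π(o) = π(q)`
  set R : Set (BondConfig (Fin n)) := openConn o q ∩ Uᶜ with hR
  have key : μ.real (U ∩ Lo) ≤ μ.real (U ∩ Lq) :=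
    hUX n w A X o q j ho hq (subset_refl _) (fun b hb => hchamp b (Finset.mem_of_mem_erase hb))
  have hfilt : ∀ ω ∈ openConn o q, (A.filter fun x => ω ∈ openConn o x) = (A.filter fun x => ω ∈ openConn q x) := by
    intro ω hoq
    have hoq' : (openGraph ω).Reachable o q := hoq
    refine Finset.filter_congr fun x _ => ⟨fun h => ?_, fun h => ?_⟩
    · exact (show (openGraph ω).Reachable q x from hoq'.symm.trans h)
    · exact (show (openGraph ω).Reachable o x from hoq'.trans h)
  have hRo : R ∩ Lo = R ∩ Lq := by
    ext ω
    simp only [mem_inter_iff, hR, hLo, hLq, mem_setOf_eq]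
    constructor
    · rintro ⟨⟨hoq, hU'⟩, h⟩; exact ⟨⟨hoq, hU'⟩, by rwa [← hfilt ω hoq]⟩
    · rintro ⟨⟨hoq, hU'⟩, h⟩; exact ⟨⟨hoq, hU'⟩, by rwa [hfilt ω hoq]⟩
  -- `{1 ≤ N} = U ∪ R` (disjointly)
  have hatt : ∀ ω : BondConfig (Fin n), 1 ≤ (A.filter fun x => ω ∈ openConn o x).card ↔ ω ∈ U ∪ R := by
    intro ω
    rw [Nat.one_le_iff_ne_zero, Ne, Finset.card_eq_zero, Finset.filter_eq_empty_iff]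
    push Not
    constructor
    · rintro ⟨a, haA, hoa⟩
      by_cases hU' : ω ∈ U
      · exact Or.inl hU'
      · refine Or.inr ⟨?_, hU'⟩
        by_contra hoq
        apply hU'
        rw [hU, mem_iUnion₂]
        refine ⟨a, Finset.mem_erase.2 ⟨?_, haA⟩, hoa⟩
        rintro rfl; exact hoq hoa
    · rintro (hU' | ⟨hoq, -⟩)
      · rw [hU, mem_iUnion₂] at hU'
        obtain ⟨b, hb, hob⟩ := hU'
        exact ⟨b, Finset.mem_of_mem_erase hb, hob⟩
      · exact ⟨q, hq, hoq⟩
  have hdisj : Disjoint U R := Set.disjoint_left.2 fun ω hU' hR' => hR'.2 hU'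
  have hmeas : ∀ s : Set (BondConfig (Fin n)), MeasurableSet s := fun _ => MeasurableSet.of_discrete
  have eL : {ω : BondConfig (Fin n) | 1 ≤ (A.filter fun x => ω ∈ openConn o x).card ∧
      (A.filter fun x => ω ∈ openConn o x).card ≤ j} = (U ∩ Lo) ∪ (R ∩ Lo) := by
    ext ω
    simp only [mem_setOf_eq, mem_union, mem_inter_iff]
    rw [hatt ω]
    simp only [mem_union, hLo, mem_setOf_eq]
    tauto
  have eR : {ω : BondConfig (Fin n) | (A.filter fun x => ω ∈ openConn q x).card ≤ j ∧
      1 ≤ (A.filter fun x => ω ∈ openConn o x).card} = (U ∩ Lq) ∪ (R ∩ Lq) := by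
    ext ω
    simp only [mem_setOf_eq, mem_union, mem_inter_iff]
    rw [hatt ω]
    simp only [mem_union, hLq, mem_setOf_eq]
    tauto
  rw [eL, eR, measureReal_union (hdisj.mono inter_subset_left inter_subset_left) (hmeas _),
    measureReal_union (hdisj.mono inter_subset_left inter_subset_left) (hmeas _), hRo]
  linarith

/-- **UX ⇒ the crux `NoHeavyLowerTail`** (through `attachedChampion_of_UX` and the lead's
`noHeavyLowerTail_of_attachedChampion`).  [cite: KozmaNitzan2024, Lemma 3(i) (pp. 6–7), Lemma 5 (p. 13)] -/
theorem noHeavyLowerTail_of_UX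
    (hUX : ∀ (n : ℕ) (w : Sym2 (Fin n) → unitInterval) (A X : Finset (Fin n)) (o q : Fin n) (j : ℕ),
      o ∉ A → q ∈ A → X ⊆ A.erase q →
      (∀ b ∈ X,
        (prodBernoulli w).real {ω : BondConfig (Fin n) | (A.filter fun x => ω ∈ openConn b x).card ≤ j} ≤
          (prodBernoulli w).real {ω : BondConfig (Fin n) | (A.filter fun x => ω ∈ openConn q x).card ≤ j}) →
      (prodBernoulli w).real ((⋃ b ∈ X, openConn o b) ∩
          {ω : BondConfig (Fin n) | (A.filter fun x => ω ∈ openConn o x).card ≤ j}) ≤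
        (prodBernoulli w).real ((⋃ b ∈ X, openConn o b) ∩
          {ω : BondConfig (Fin n) | (A.filter fun x => ω ∈ openConn q x).card ≤ j})) :
    Summit.CriticalPhenomena.PercolationContinuityZ3.Theses.PercNearOneGluing.NoHeavyLowerTail :=
  noHeavyLowerTail_of_attachedChampion fun n w A o q j ho hq hchamp =>
    attachedChampion_of_UX hUX n w A o q j ho hq hchamp

end Summit.CriticalPhenomena.PercolationContinuityZ3.Theorems

end
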